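import Summits.ABC.IUTFork.Thm311Pilot
import Summits.ABC.IUTFork.Thm311MultiradProofs
import Summits.ABC.IUTFork.Thm311SigProofs

/-!
# [IUTchIII] Theorem 3.11 / Corollary 3.12's nouns: bridges to `Thm311Pilot` — proofs

PROOF-ONLY companion (no new definitions, no new signatures) to seat abc-iut-c312-1's record-only file G
`Thm311Pilot` of the abc-iut cell; TAKES NO SIDE. Written by the wave-2 support seat abc-iut-L6-t13
(plan/WAVE2-SLICES.tsv row 63). It restates, in file G's vocabulary (`LogShells.IndGroup`,
`PilotNouns.possibleImages`, `LatticeSituation.LogvolIndInvariant`), the structure theorems proved over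
files A/B in `Thm311MultiradProofs` and `Thm311SigProofs`:

* `MRData.mem_RLGP_iff_exists_mem_indGroup`: `D' ∈ R^LGP(D) ↔ ∃ Φ ∈ IndGroup, D' = D.map Φ` — the class
  "regarded up to (Ind1), (Ind2)" of [IUTchIII] Thm. 3.11 (i) (file B) is ONE ORBIT under the group of
  file G.
* `LatticeSituation.logvolIndInvariant_of_logvolInvariant`: G's WHOLE-GROUP hypothesis
  `LogvolIndInvariant S n j v_ℚ` (what [IUTchIV] Thm. 1.10 Step (v) uses of (Ind1), (Ind2)) follows from
  B's GENERATOR-LEVEL `LogvolInvariant (S.D n)` plus transport of admissibility by the generating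
  families — so an instantiation proves invariance for ONE procession automorphism / ONE family of
  copies of Ism at a time, never for words in them.
* `PilotNouns.possibleImages_eq_of_hyps`: under (HI)/(HS)/(HN) of `Thm311SigProofs` (Ism and the
  strip-automorphisms closed under composition/inverse, strip-automorphisms normalise Ism), "the possible
  images of a Θ-pilot object" (Cor. 3.12; G: orbit of the (Ind3)-enlarged region under `IndGroup`) are
  exactly the regions `Φ₂(Φ₁(−))` for ONE (Ind1)-family `Φ₁` and ONE (Ind2)-family `Φ₂` — Dupuy–Hilado's
  `U_Θ := Ind2(Ind1((O_𝕃(−P_Θ))^{Ind3}))` (arXiv:2004.13228 §4.11), in the author's terms.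

Sources read on the page: [IUTchIII] kurims pp. 153–155 (Thm. 3.11 (i)), 173–174 (Cor. 3.12).
[claim: Mochizuki2012, status: disputed] for the quoted statements; [cite: DupuyHilado2025, §4.11];
every theorem below is [folklore]. Deliberately NOT here: any definition; any judgement.
-/

open scoped Pointwise

namespace Summit.ABC

namespace IUTFork

namespace Thm311

variable {T : ThetaIndex}

namespace LogShells

variable (L : LogShells T)

/-- The capsule-index permutations alone — with identity strip-automorphisms — are (Ind1)-moves at every
label (file A's `Ind1`, witness `h = refl`): the indeterminacy group is never smaller than
`∏_j Sym(S^±_{j+1})`, whatever the instantiated `stripAut`/`ism`. [folklore] -/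
theorem permute_mem_Ind1 (j : T.Label) (σ : Equiv.Perm (T.Caps j)) :
    (fun vQ => L.permute j vQ σ) ∈ L.Ind1 j := by
  refine ⟨σ, fun _ v => LinearEquiv.refl ℚ (L.carrier v), fun _ v => L.one_mem_stripAut v, fun vQ => ?_⟩
  rw [summandwise_refl_family, factorwise_refl, LinearEquiv.trans_refl]

/-- A choice of one capsule-index permutation per label is an (Ind1)-family. [folklore] -/
theorem permuteFamily_mem_Ind1Family (σ : ∀ j : T.Label, Equiv.Perm (T.Caps j)) :
    (fun j vQ => L.permute j vQ (σ j)) ∈ L.Ind1Family :=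
  fun j => L.permute_mem_Ind1 j (σ j)

/-- … hence an element of file G's `IndGroup`. [folklore] -/
theorem permuteFamily_mem_indGroup (σ : ∀ j : T.Label, Equiv.Perm (T.Caps j)) :
    (fun j vQ => L.permute j vQ (σ j)) ∈ L.IndGroup :=
  L.ind1Family_subset_indGroup (L.permuteFamily_mem_Ind1Family σ)

end LogShells

namespace MRData

variable {L : LogShells T}

/-- Relabelling the capsule indices of the data (a), (b), (c) by any permutations stays inside the class
`R^LGP` — hypothesis-free lower bound on the size of "the possible images". [folklore] -/
theorem map_permuteFamily_mem_RLGP (D : MRData L) (σ : ∀ j : T.Label, Equiv.Perm (T.Caps j)) :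
    D.map (fun j vQ => L.permute j vQ (σ j)) ∈ D.RLGP :=
  D.map_mem_RLGP (L.permuteFamily_mem_indGroup σ)

/-- **`R^LGP` is one `IndGroup`-orbit** ([IUTchIII] Thm. 3.11 (i) "regarded up to (Ind1), (Ind2)", in
the vocabulary of file G): `D' ∈ R^LGP(D)` iff `D' = D.map Φ` for some `Φ` in the subgroup generated by
the (Ind1)- and (Ind2)-families. [folklore] -/
theorem mem_RLGP_iff_exists_mem_indGroup (D D' : MRData L) :
    D' ∈ D.RLGP ↔ ∃ Φ ∈ L.IndGroup, D' = D.map Φ :=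
  mem_RLGP_iff D D'

/-- `R^LGP(D)` is the image of `IndGroup` under `Φ ↦ D.map Φ`. [folklore] -/
theorem RLGP_eq_image_indGroup (D : MRData L) :
    D.RLGP = (fun Φ : L.PacketAut => D.map Φ) '' (L.IndGroup : Set L.PacketAut) :=
  RLGP_eq_image_closure D

/-- Transport along an element of `IndGroup` does not change the class `R^LGP`. [folklore] -/
theorem RLGP_map_eq_of_mem_indGroup (D : MRData L) {Φ : L.PacketAut} (hΦ : Φ ∈ L.IndGroup) :
    (D.map Φ).RLGP = D.RLGP :=
  RLGP_map_eq_of_mem_closure D hΦ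

end MRData

namespace Situation

/-- Thm. 3.11 (i)'s concluding compatibility AS TYPED (`MultiradialCompat`), in the vocabulary of file
G: the data of any two vertical lines differ by one element of `IndGroup`. Neither side asserted.
[folklore] -/
theorem multiradialCompat_iff_indGroup (S : Situation T) :
    S.MultiradialCompat ↔ ∀ n n' : ℤ, ∃ Φ ∈ S.L.IndGroup, S.D n' = (S.D n).map Φ :=
  multiradialCompat_iff S

end Situation

namespace LatticeSituation

/-- **Generator-level ⇒ group-level log-volume invariance.** File G's hypothesis
`LogvolIndInvariant S n j v_ℚ` (every element of `IndGroup` carries admissible regions of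
`I^ℚ(^{S^±_{j+1}};^{n,∘}D⊢_{v_ℚ})` to admissible regions of the same log-volume) follows from file B's
`LogvolInvariant (S.D n)` (the same for single (Ind1)- or (Ind2)-families) together with: the generating
families carry admissible regions to admissible regions, in both directions. [folklore] -/
theorem logvolIndInvariant_of_logvolInvariant (S : LatticeSituation T) (n : ℤ)
    (hAdm : ∀ Φ ∈ S.L.Ind1Family ∪ S.L.Ind2Family, ∀ j vQ (A : Set (S.L.Packet j vQ)),
      (S.D n).Adm j vQ A ↔ (S.D n).Adm j vQ (Φ j vQ '' A))
    (hvol : (S.D n).LogvolInvariant) (j : T.LabelStar) (vQ : T.VQ) : S.LogvolIndInvariant n j vQ :=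
  fun _Φ hΦ A hA => MRData.adm_and_logvol_eq_of_mem_closure (S.D n) hAdm hvol hΦ j.1 vQ A hA

end LatticeSituation

namespace PilotNouns

variable {S : LatticeSituation T} (P : PilotNouns S)

/-- **The possible images of a Θ-pilot object, author's terms = Dupuy–Hilado's `Ind2(Ind1(−))`.**
Under (HI) `ism v` and (HS) `stripAut v` closed under composition and inverse and (HN) `stripAut v`
normalises `ism v`, the set of possible images at `(j, v_ℚ)` (file G: the `IndGroup`-orbit of the
(Ind3)-enlarged Θ-pilot region) consists exactly of the regions obtained by applying ONE (Ind1)-family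
and then ONE (Ind2)-family ([IUTchIII] Cor. 3.12 "the union of the possible images of a Θ-pilot object …
subject to the indeterminacies (Ind1), (Ind2), (Ind3)"; Dupuy–Hilado §4.11). [folklore] -/
theorem possibleImages_eq_of_hyps
    (hS : ∀ v, ∀ a ∈ S.L.stripAut v, ∀ b ∈ S.L.stripAut v, a * b ∈ S.L.stripAut v)
    (hS' : ∀ v, ∀ a ∈ S.L.stripAut v, a⁻¹ ∈ S.L.stripAut v)
    (hN : ∀ v, ∀ a ∈ S.L.stripAut v, ∀ g ∈ S.L.ism v, a * g * a⁻¹ ∈ S.L.ism v)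
    (hI : ∀ v, ∀ a ∈ S.L.ism v, ∀ b ∈ S.L.ism v, a * b ∈ S.L.ism v)
    (hI' : ∀ v, ∀ a ∈ S.L.ism v, a⁻¹ ∈ S.L.ism v)
    (n m : ℤ) (j : T.LabelStar) (vQ : T.VQ) :
    P.possibleImages n m j vQ =
      {R | ∃ Φ₁ ∈ S.L.Ind1Family, ∃ Φ₂ ∈ S.L.Ind2Family,
        R = Φ₂ j.1 vQ '' (Φ₁ j.1 vQ '' P.thetaRegion3 n m j vQ)} :=
  LogShells.image_closure_eq hS hS' hN hI hI' j.1 vQ (P.thetaRegion3 n m j vQ)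

/-- Under the same hypotheses, the UNION of the possible images (whose holomorphic hull carries
`−|log(Θ)|`, Cor. 3.12) is the union over pairs (one (Ind1)-family, one (Ind2)-family). [folklore] -/
theorem sUnion_possibleImages_eq_of_hyps
    (hS : ∀ v, ∀ a ∈ S.L.stripAut v, ∀ b ∈ S.L.stripAut v, a * b ∈ S.L.stripAut v)
    (hS' : ∀ v, ∀ a ∈ S.L.stripAut v, a⁻¹ ∈ S.L.stripAut v)
    (hN : ∀ v, ∀ a ∈ S.L.stripAut v, ∀ g ∈ S.L.ism v, a * g * a⁻¹ ∈ S.L.ism v)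
    (hI : ∀ v, ∀ a ∈ S.L.ism v, ∀ b ∈ S.L.ism v, a * b ∈ S.L.ism v)
    (hI' : ∀ v, ∀ a ∈ S.L.ism v, a⁻¹ ∈ S.L.ism v)
    (n m : ℤ) (j : T.LabelStar) (vQ : T.VQ) :
    ⋃₀ P.possibleImages n m j vQ =
      ⋃ Φ₁ ∈ S.L.Ind1Family, ⋃ Φ₂ ∈ S.L.Ind2Family,
        Φ₂ j.1 vQ '' (Φ₁ j.1 vQ '' P.thetaRegion3 n m j vQ) := by
  rw [P.possibleImages_eq_of_hyps hS hS' hN hI hI']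
  ext x
  simp only [Set.mem_sUnion, Set.mem_setOf_eq, Set.mem_iUnion]
  constructor
  · rintro ⟨R, ⟨Φ₁, h₁, Φ₂, h₂, rfl⟩, hx⟩
    exact ⟨Φ₁, h₁, Φ₂, h₂, hx⟩
  · rintro ⟨Φ₁, h₁, Φ₂, h₂, hx⟩
    exact ⟨_, ⟨Φ₁, h₁, Φ₂, h₂, rfl⟩, hx⟩

/-- Every possible image is admissible with the log-volume of the (Ind3)-enlarged region, from the
GENERATOR-LEVEL hypotheses of file B (via `logvolIndInvariant_of_logvolInvariant` and G's
`logvol_eq_of_mem_possibleImages`). [folklore] -/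
theorem logvol_eq_of_mem_possibleImages_of_logvolInvariant {n m : ℤ} {j : T.LabelStar} {vQ : T.VQ}
    (hAdm : ∀ Φ ∈ S.L.Ind1Family ∪ S.L.Ind2Family, ∀ j vQ (A : Set (S.L.Packet j vQ)),
      (S.D n).Adm j vQ A ↔ (S.D n).Adm j vQ (Φ j vQ '' A))
    (hvol : (S.D n).LogvolInvariant) (hadm : (S.D n).Adm j.1 vQ (P.thetaRegion3 n m j vQ))
    {R : Set (S.L.Packet j.1 vQ)} (hR : R ∈ P.possibleImages n m j vQ) :
    (S.D n).Adm j.1 vQ R ∧ (S.D n).logvol j.1 vQ R = (S.D n).logvol j.1 vQ (P.thetaRegion3 n m j vQ) :=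
  P.logvol_eq_of_mem_possibleImages (S.logvolIndInvariant_of_logvolInvariant n hAdm hvol j vQ) hadm hR

end PilotNouns

end Thm311

end IUTFork

end Summit.ABC
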